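import Summits.ValiantsHypothesis.ValiantsHypothesis.Theorems.SymPencilPerFourRowStabilizer
import Mathlib.LinearAlgebra.FiniteDimensional.Lemmas

/-!
# Route `SymPencil` — the one-row kernel cell: the endgame (from the two base-point identities
# to a contradiction)  (`--supports` stmt-ValiantsHypothesis-5674; rung currency for `sdc(per_4)`,
# nothing here bears on `VP ≠ VNP`)

Abstract form of the kill of the cells `(12,4,0)` (size `25`) and `(12,4,1)` (size `26`) of a
symmetric affine determinantal representation of `per_4` whose kernel space `V = ker b` is ONE ROW.
Write `F_v(x) = per [v; x 0; x 1; x 2]` (`v ∈ K⁴` the kernel row, `x` the other three rows) and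
`DF_v(x)[y] = per [v; y 0; x 1; x 2] + per [v; x 0; y 1; x 2] + per [v; x 0; x 1; y 2]`.  The
base-point expansion (`SymPencilPerFourBasePointPackage`, `SymPencilPerFourOneRowKernel`) produces
a function `Θ(x)[·]` (linear), linear maps `K(v)`, and scalars `δ₀ ≠ 0`, `δ₁(v)`, `c ≠ 0` with

  (K0) `δ₀ · Θ(x)[K(v)x] = c · F_v(x)`,      (K1) `δ₁(v) · Θ(x)[K(v)x] = c · DF_v(x)[K(v)x]`

for all `v, x` (the `t⁰`- and `t¹`-coefficients of `det(D + tC(v)) Θ = c F_v(x + t K(v)x)`).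

**Theorem** (`false_of_oneRow_identities`): no such data exist.  Proof: (K0),(K1) and Euler
(`DF_v(x)[x] = 3 F_v(x)`) give `DF_v(x)[(K(v) - δ₁(v)/(3δ₀)) x] = 0`; for `v` with all entries
non-zero the stabiliser theorem (`SymPencilPerFourRowStabilizer.rowScaling_of_deriv_vanish`)
makes `K(v)` a ROW SCALING `x_a ↦ d_a(v) x_a`, and then (K0) puts `F_v` in the span of the three
fixed cubics `g_a(x) = Θ(x)[row a of x]` (`exists_rowScaling`).  Taking `v = 𝟙 + e_i`
(`i = 0..3`) gives four cubics `F_v` in a `3`-dimensional span, but they are linearly independent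
(test matrices `x^{(j)}` = the coordinate rows off column `j`, where `F_v(x^{(j)}) = v_j` and the
value matrix `1 + δ_{ij}` is invertible, `5 ≠ 0`).  Characteristic `0`. [folklore]
-/

noncomputable section

-- single-conjunct layout: Sub = Summit, duplicated namespace component intended
set_option linter.dupNamespace false

namespace Summit.ValiantsHypothesis.ValiantsHypothesis.Theorems.SymPencilPerFourOneRowEndgame

open Matrix Module
open Summit.ValiantsHypothesis.ValiantsHypothesis.Theorems.SymPencilPerFourInnerRankRows
open Summit.ValiantsHypothesis.ValiantsHypothesis.Theorems.SymPencilPerFourRowForms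
open Summit.ValiantsHypothesis.ValiantsHypothesis.Theorems.SymPencilPerFourRowStabilizer

variable {K : Type*} [Field K]

/-! ### Two more pieces of row bookkeeping -/

/-- **Expansion of `F_v(x + t y)` in `t`**: constant term `F_v(x)`, linear term `DF_v(x)[y]`, then
the mixed term and `F_v(y)`. [folklore] -/
theorem permanent_rows_add_smul (v : Fin 4 → K) (x y : Fin 3 → Fin 4 → K) (t : K) :
    (Matrix.of ![v, x 0 + t • y 0, x 1 + t • y 1, x 2 + t • y 2]).permanent =
      (Matrix.of ![v, x 0, x 1, x 2]).permanent +
      t * ((Matrix.of ![v, y 0, x 1, x 2]).permanent + (Matrix.of ![v, x 0, y 1, x 2]).permanent +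
        (Matrix.of ![v, x 0, x 1, y 2]).permanent) +
      t ^ 2 * ((Matrix.of ![v, x 0, y 1, y 2]).permanent +
        (Matrix.of ![v, y 0, x 1, y 2]).permanent + (Matrix.of ![v, y 0, y 1, x 2]).permanent) +
      t ^ 3 * (Matrix.of ![v, y 0, y 1, y 2]).permanent := by
  simp only [permanent_of_rows, Pi.add_apply, Pi.smul_apply, smul_eq_mul]
  ring

/-- **Euler along a correction**: `DF_v(x)[y - s x] = DF_v(x)[y] - 3 s F_v(x)`. [folklore] -/
theorem permanent_rows_deriv_sub_smul (v : Fin 4 → K) (x y : Fin 3 → Fin 4 → K) (s : K) :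
    (Matrix.of ![v, y 0 - s • x 0, x 1, x 2]).permanent +
      (Matrix.of ![v, x 0, y 1 - s • x 1, x 2]).permanent +
      (Matrix.of ![v, x 0, x 1, y 2 - s • x 2]).permanent =
    ((Matrix.of ![v, y 0, x 1, x 2]).permanent + (Matrix.of ![v, x 0, y 1, x 2]).permanent +
      (Matrix.of ![v, x 0, x 1, y 2]).permanent) -
      3 * s * (Matrix.of ![v, x 0, x 1, x 2]).permanent := by
  simp only [permanent_of_rows, Pi.sub_apply, Pi.smul_apply, smul_eq_mul]
  ring

/-- `succAbove` values on `Fin 4`. [folklore] -/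
theorem succAbove_table :
    ((0 : Fin 4).succAbove 0 = 1 ∧ (0 : Fin 4).succAbove 1 = 2 ∧ (0 : Fin 4).succAbove 2 = 3) ∧
    ((1 : Fin 4).succAbove 0 = 0 ∧ (1 : Fin 4).succAbove 1 = 2 ∧ (1 : Fin 4).succAbove 2 = 3) ∧
    ((2 : Fin 4).succAbove 0 = 0 ∧ (2 : Fin 4).succAbove 1 = 1 ∧ (2 : Fin 4).succAbove 2 = 3) ∧
    ((3 : Fin 4).succAbove 0 = 0 ∧ (3 : Fin 4).succAbove 1 = 1 ∧ (3 : Fin 4).succAbove 2 = 2) := by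
  decide

/-- **Test matrices**: on the three coordinate rows off column `j` (in order), `F_v = v_j`.
[folklore] -/
theorem permanent_rows_test (v : Fin 4 → K) (j : Fin 4) :
    (Matrix.of ![v, Pi.single (j.succAbove 0) (1 : K), Pi.single (j.succAbove 1) (1 : K),
      Pi.single (j.succAbove 2) (1 : K)]).permanent = v j := by
  obtain ⟨⟨a0, a1, a2⟩, ⟨b0, b1, b2⟩, ⟨c0, c1, c2⟩, ⟨d0, d1, d2⟩⟩ := succAbove_table
  have h4 : ∀ i : Fin 4, i = 0 ∨ i = 1 ∨ i = 2 ∨ i = 3 := by decide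
  rcases h4 j with rfl | rfl | rfl | rfl
  · rw [a0, a1, a2]; exact permanent_rows_three_single v 1 2 3 0 (by decide)
  · rw [b0, b1, b2]; exact permanent_rows_three_single v 0 2 3 1 (by decide)
  · rw [c0, c1, c2]; exact permanent_rows_three_single v 0 1 3 2 (by decide)
  · rw [d0, d1, d2]; exact permanent_rows_three_single v 0 1 2 3 (by decide)

variable [CharZero K]

/-! ### One good base row: `K(v)` is a row scaling and `F_v` lies in a fixed 3-span -/

/-- **(K0) + (K1) at one base row with non-zero entries ⇒ `F_v ∈ span{g₀, g₁, g₂}`** with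
`g_a(x) = Θ(x)[row a of x]`.  See the module docstring. [folklore] -/
theorem exists_rowScaling {v : Fin 4 → K} (hv : ∀ j, v j ≠ 0)
    (Θ : (Fin 3 → Fin 4 → K) → ((Fin 3 → Fin 4 → K) →ₗ[K] K))
    (Kx : (Fin 3 → Fin 4 → K) →ₗ[K] (Fin 3 → Fin 4 → K)) {δ₀ δ₁ c : K} (hδ₀ : δ₀ ≠ 0)
    (hc : c ≠ 0)
    (h0 : ∀ x, δ₀ * Θ x (Kx x) = c * (Matrix.of ![v, x 0, x 1, x 2]).permanent)
    (h1 : ∀ x, δ₁ * Θ x (Kx x) =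
      c * ((Matrix.of ![v, Kx x 0, x 1, x 2]).permanent +
        (Matrix.of ![v, x 0, Kx x 1, x 2]).permanent +
        (Matrix.of ![v, x 0, x 1, Kx x 2]).permanent)) :
    ∃ d : Fin 3 → K, ∀ x, c * (Matrix.of ![v, x 0, x 1, x 2]).permanent =
      δ₀ * ∑ a : Fin 3, d a * Θ x (Pi.single a (x a)) := by
  obtain ⟨s, e3⟩ : ∃ s : K, δ₀ * (3 * s) = δ₁ :=
    ⟨δ₁ / (3 * δ₀), by field_simp⟩
  set X : (Fin 3 → Fin 4 → K) →ₗ[K] (Fin 3 → Fin 4 → K) := Kx - s • LinearMap.id with hXdef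
  have hXa : ∀ x a, X x a = Kx x a - s • x a := fun x a => by
    simp [hXdef, LinearMap.sub_apply, LinearMap.smul_apply]
  -- Euler: `DF_v(x)[X x] = 0`
  have hX : ∀ x : Fin 3 → Fin 4 → K,
      (Matrix.of ![v, X x 0, x 1, x 2]).permanent + (Matrix.of ![v, x 0, X x 1, x 2]).permanent +
        (Matrix.of ![v, x 0, x 1, X x 2]).permanent = 0 := by
    intro x
    have e := permanent_rows_deriv_sub_smul v x (Kx x) s
    have a0 := h0 x
    have a1 := h1 x
    rw [hXa, hXa, hXa, e]
    have h2 : (δ₀ * c) * (((Matrix.of ![v, Kx x 0, x 1, x 2]).permanent +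
        (Matrix.of ![v, x 0, Kx x 1, x 2]).permanent + (Matrix.of ![v, x 0, x 1, Kx x 2]).permanent)
        - 3 * s * (Matrix.of ![v, x 0, x 1, x 2]).permanent) = 0 := by
      linear_combination (-δ₀) * a1 + (3 * s * δ₀) * a0 - (δ₀ * Θ x (Kx x)) * e3
    exact (mul_eq_zero.1 h2).resolve_left (mul_ne_zero hδ₀ hc)
  obtain ⟨α, -, hα⟩ := rowScaling_of_deriv_vanish hv X hX
  refine ⟨fun a => α a + s, fun x => ?_⟩
  have hKa : ∀ a, Kx x a = (α a + s) • x a := fun a => by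
    have h := hα x a
    rw [hXa, sub_eq_iff_eq_add] at h
    rw [h, add_smul]
  have hK : Kx x = ∑ a, Pi.single a ((α a + s) • x a) := by
    rw [Finset.univ_sum_single (fun a => (α a + s) • x a)]
    exact funext hKa
  rw [← h0 x, hK, map_sum, Finset.mul_sum, Finset.mul_sum]
  refine Finset.sum_congr rfl fun a _ => ?_
  rw [Pi.single_smul', map_smul, smul_eq_mul]

/-! ### Four base rows: the contradiction -/

/-- **No one-row kernel: the endgame.**  The identities (K0), (K1) of the module docstring are
jointly impossible (characteristic `0`). [folklore] -/
theorem false_of_oneRow_identities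
    (Θ : (Fin 3 → Fin 4 → K) → ((Fin 3 → Fin 4 → K) →ₗ[K] K))
    (Kv : (Fin 4 → K) → (Fin 3 → Fin 4 → K) →ₗ[K] (Fin 3 → Fin 4 → K))
    {δ₀ c : K} (δ₁ : (Fin 4 → K) → K) (hδ₀ : δ₀ ≠ 0) (hc : c ≠ 0)
    (h0 : ∀ v x, δ₀ * Θ x (Kv v x) = c * (Matrix.of ![v, x 0, x 1, x 2]).permanent)
    (h1 : ∀ v x, δ₁ v * Θ x (Kv v x) =
      c * ((Matrix.of ![v, Kv v x 0, x 1, x 2]).permanent +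
        (Matrix.of ![v, x 0, Kv v x 1, x 2]).permanent +
        (Matrix.of ![v, x 0, x 1, Kv v x 2]).permanent)) :
    False := by
  -- the four base rows `𝟙 + e_i`
  set vv : Fin 4 → (Fin 4 → K) := fun i j => 1 + (Pi.single i (1 : K) : Fin 4 → K) j with hvv
  have hvv0 : ∀ i j, vv i j ≠ 0 := by
    intro i j
    by_cases h : j = i
    · subst h; simp [hvv]
    · simp [hvv, h]
  choose d hd using fun i =>
    exists_rowScaling (hvv0 i) Θ (Kv (vv i)) hδ₀ hc (h0 (vv i)) (h1 (vv i))
  -- a non-trivial relation among the four scaling vectors `d i ∈ K³`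
  have hdep : ¬ LinearIndependent K d := by
    intro hli
    have h := hli.fintype_card_le_finrank
    rw [Fintype.card_fin, Module.finrank_fin_fun] at h
    omega
  obtain ⟨μ, hμ, i₀, hi₀⟩ := Fintype.not_linearIndependent_iff.1 hdep
  have hμa : ∀ a, ∑ i, μ i * d i a = 0 := fun a => by
    have h := congr_fun hμ a
    simpa only [Finset.sum_apply, Pi.smul_apply, smul_eq_mul, Pi.zero_apply] using h
  -- `Σ_i μ_i F_{vv i} ≡ 0`
  have hsum : ∀ x : Fin 3 → Fin 4 → K,
      ∑ i, μ i * (Matrix.of ![vv i, x 0, x 1, x 2]).permanent = 0 := by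
    intro x
    have h3 : ∀ i, c * (μ i * (Matrix.of ![vv i, x 0, x 1, x 2]).permanent) =
        δ₀ * ∑ a : Fin 3, (μ i * d i a) * Θ x (Pi.single a (x a)) := fun i => by
      rw [mul_left_comm, hd i x, Finset.mul_sum, Finset.mul_sum, Finset.mul_sum]
      exact Finset.sum_congr rfl fun a _ => by ring
    have h2 : c * ∑ i, μ i * (Matrix.of ![vv i, x 0, x 1, x 2]).permanent = 0 := by
      rw [Finset.mul_sum, Finset.sum_congr rfl fun i _ => h3 i, ← Finset.mul_sum,
        Finset.sum_comm]
      simp only [← Finset.sum_mul, hμa, zero_mul, Finset.sum_const_zero, mul_zero]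
    exact (mul_eq_zero.1 h2).resolve_left hc
  -- evaluate at the test matrices: `Σ_i μ_i (1 + δ_ij) = 0`
  have hev : ∀ j, (∑ i, μ i) + μ j = 0 := by
    intro j
    have h := hsum ![Pi.single (j.succAbove 0) (1 : K), Pi.single (j.succAbove 1) (1 : K),
      Pi.single (j.succAbove 2) (1 : K)]
    simp only [Matrix.cons_val_zero, Matrix.cons_val_one, Matrix.cons_val_two, Matrix.head_cons,
      Matrix.tail_cons, permanent_rows_test, hvv, mul_add, mul_one, Finset.sum_add_distrib] at h
    have hδ : ∑ i, μ i * (Pi.single i (1 : K) : Fin 4 → K) j = μ j := by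
      simp only [Pi.single_apply, mul_ite, mul_one, mul_zero, Finset.sum_ite_eq,
        Finset.mem_univ, if_true]
    rwa [hδ] at h
  have hS : (5 : K) * ∑ i, μ i = 0 := by
    have e := Fin.sum_univ_four μ
    linear_combination hev 0 + hev 1 + hev 2 + hev 3 + e
  have hS0 : ∑ i, μ i = 0 := (mul_eq_zero.1 hS).resolve_left (by norm_num)
  have hμ0 : μ i₀ = 0 := by have h := hev i₀; rwa [hS0, zero_add] at h
  exact hi₀ hμ0

end Summit.ValiantsHypothesis.ValiantsHypothesis.Theorems.SymPencilPerFourOneRowEndgame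

end
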